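import Mathlib
import HarnessLib.Audit
import Summits.PneNP.PneNP.Theorems.PstarCrossSystem
import Summits.PneNP.PneNP.Theorems.PstarChordBridgeForcing

/-!
# The blind free CROSS gate: CORNER SQUARES — a quadratic constant on the corner `{u_p = u_q = 0}` does not read a private tree edge (O2 / E1; prover-1 g22)

FRONTIER range-avoidance ladder, rung F-N3 (`stmt-PneNP-19007`), cell `pnp-ideate` (planner memo `r24/CORE-BOUND-NOTES.md` §14.42–§14.47: the coupling
classification, here in a LOCAL basis-free form); restricted-model proof complexity — nothing here bears on `P` versus `NP`.

In every regime of the virtual-chord line some quadratic `q` of the bridge data (regime P: `q_{(1,0)} = F₂ + t₂`, which is `≡ 1` on the corner by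
`PstarCrossCaseP.orU_of_q`; regime T / U2: `F₂ + σ₂ + t₂` resp. `q_{(0,1)}`-type forms, by corner forcing) is CONSTANT on the corner
`K = {u_p = 0} ∩ {u_q = 0}` of the two gate chords.  This file extracts what that says about the AND variables of a PRIVATE tree edge `π`
(both AND variables read by no other output of the core), with no normal form and no share-freeness assumption elsewhere:

* `polar_zero_of_square`, `lin_eq_of_pair` — for any quadratic `q` (polar identity with form `Bq`) constant on a set containing the square
  `a, a+v, a+w, a+v+w`: `Bq v w = 0`; containing `a, a+v`: `q v + q 0 = Bq a v`.
* `ind`, `ind_insert`, `qform_ind`, `u_ind` — indicator points of variable sets and the prescribed products there: if the tree edges of `D e` having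
  both AND variables inside `W` are exactly those in `S`, then `u_e(𝟙_W) = γ_e + #(D e ∩ S)`.
* **`corner_square`** — the instance lemma: `S` a set of PRIVATE tree edges switched ON (`W = ⋃_{j∈S} {a_j, b_j}`) putting `𝟙_W` in the corner
  (`γ_p + #(D_p ∩ S) = 0 = γ_q + #(D_q ∩ S)`), `π ∉ S` a private tree edge with AND variable `v` and mate `v'`, and `w ∉ W` any variable other than
  `v, v'`: the four points `𝟙_W + {0, e_v, e_w, e_v + e_w}` lie in the corner, hence **`Bq(e_w, e_v) = 0`** for every quadratic `q` constant on the
  corner; `corner_pair` — and `q(e_v) + q(0) = Bq(𝟙_W, e_v)`.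
So a corner-constant `q` touches the AND variable `v` of a private tree edge at most through the tree monomial of `π` itself and through variables
of the switched-on edges — the only freedom left is WHICH private edges can be switched on, i.e. the sizes and levels of the Venn classes of
`(D_p, D_q)`: the small-class / level-`1` configurations are the planner's PINS (memo §14.42).
-/

set_option linter.dupNamespace false -- `Summit.PneNP.PneNP.…`: summit = sub-problem name (D-0017 single-conjunct layout)

open Finset Literature.Computability.Complexity
open Summit.PneNP.PneNP.Theorems.PstarFibrePolys (bit)
open Summit.PneNP.PneNP.Theorems.PstarTyped (Typed)
open Summit.PneNP.PneNP.Theorems.PstarSALevel (varSet)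
open Summit.PneNP.PneNP.Theorems.PstarCentreFree (vars_mem_varSet)
open Summit.PneNP.PneNP.Theorems.PstarProductRank (qform polar)
open Summit.PneNP.PneNP.Theorems.PstarChordSystem (ChordSystem)
open Summit.PneNP.PneNP.Theorems.PstarChordBridgeTools
open Summit.PneNP.PneNP.Theorems.PstarChordBridge
open Summit.PneNP.PneNP.Theorems.PstarChordBridgeForcing (gam sys_u_eq)
open Summit.PneNP.PneNP.Theorems.PstarCrossData (CrossData)

namespace Summit.PneNP.PneNP.Theorems.PstarCrossCorner

variable {n m : ℕ}

/-! ## Squares and pairs inside a level set of a quadratic -/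

section Abstract

variable {M : Type*} [AddCommGroup M] [Module (ZMod 2) M] {q : M → ZMod 2} {Bq : LinearMap.BilinForm (ZMod 2) M}

/-- **A square inside a level set kills the polar form**: if `q` (polar identity with `Bq`) takes the same value at `a, a+v, a+w, a+v+w`, then
`Bq v w = 0`. -/
theorem polar_zero_of_square (hq : ∀ x y, q (x + y) = q x + q y + q 0 + Bq x y) {a v w : M} {κ : ZMod 2}
    (h00 : q a = κ) (h10 : q (a + v) = κ) (h01 : q (a + w) = κ) (h11 : q (a + v + w) = κ) : Bq v w = 0 := by
  have e1 := hq a w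
  have e2 := hq (a + v) w
  rw [LinearMap.map_add] at e2
  rw [h00] at e1
  rw [h11, h10, LinearMap.add_apply] at e2
  rw [h01] at e1
  have h3 : ∀ k qw q0 baw bvw : ZMod 2, k = k + qw + q0 + baw → k = k + qw + q0 + (baw + bvw) → bvw = 0 := by decide
  exact h3 _ _ _ _ _ e1 e2

/-- **A pair inside a level set reads the linear coefficient**: `q` equal at `a` and `a + v` gives `q v + q 0 = Bq a v`. -/
theorem lin_eq_of_pair (hq : ∀ x y, q (x + y) = q x + q y + q 0 + Bq x y) {a v : M} {κ : ZMod 2} (h0 : q a = κ) (h1 : q (a + v) = κ) :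
    q v + q 0 = Bq a v := by
  have e1 := hq a v
  rw [h1, h0] at e1
  have h3 : ∀ k qv q0 b : ZMod 2, k = k + qv + q0 + b → qv + q0 = b := by decide
  exact h3 _ _ _ _ e1

end Abstract

/-! ## Indicator points and the prescribed products there -/

/-- The indicator point of a set of variables. -/
def ind (W : Finset (Fin n)) : Fin n → ZMod 2 := fun v => if v ∈ W then 1 else 0

/-- Adding a basis vector outside the support inserts the variable. -/
theorem ind_insert {W : Finset (Fin n)} {v : Fin n} (hv : v ∉ W) : ind (insert v W) = ind W + Pi.single v 1 := by
  classical
  funext u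
  unfold ind
  simp only [mem_insert, Pi.add_apply, Pi.single_apply]
  by_cases huv : u = v
  · subst huv; simp [hv]
  · simp [huv]

/-- The AND-sum at an indicator point counts the edges with both AND variables inside. -/
theorem qform_ind (I : LocalMap 4 n m) (D : Finset (Fin m)) (W : Finset (Fin n)) :
    qform D (fun j => I.vars j 2) (fun j => I.vars j 3) (ind W) = ((D.filter fun j => I.vars j 2 ∈ W ∧ I.vars j 3 ∈ W).card : ZMod 2) := by
  classical
  unfold qform ind
  rw [card_eq_sum_ones, Nat.cast_sum, sum_filter]
  refine sum_congr rfl fun j _ => ?_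
  by_cases h2 : I.vars j 2 ∈ W <;> by_cases h3 : I.vars j 3 ∈ W <;> simp [h2, h3]

/-- **The prescribed product at an indicator point**: if the edges of `D e` with both AND variables in `W` are exactly those in `S`, then
`u_e(𝟙_W) = γ_e + #(D e ∩ S)`. -/
theorem u_ind (I : LocalMap 4 n m) (B : BridgeData n m) (e : Fin m) {W : Finset (Fin n)} {S : Finset (Fin m)}
    (hW : ∀ k ∈ B.D e, (I.vars k 2 ∈ W ∧ I.vars k 3 ∈ W) ↔ k ∈ S) :
    (sys I B).u e (ind W) = gam B e + (((B.D e).filter fun k => k ∈ S).card : ZMod 2) := by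
  classical
  rw [sys_u_eq, qform_ind]
  congr 3
  exact filter_congr fun k hk => hW k hk

/-! ## The instance lemma: switching on private tree edges -/

section Instance

variable (I : LocalMap 4 n m) {r : ℕ} {B : BridgeData n m} {e_p e_q g₀ : Fin m}

/-- A tree edge is PRIVATE in the core: its AND variables occur in no other output of `J₀`. -/
def PrivEdge (I : LocalMap 4 n m) (B : BridgeData n m) (j : Fin m) : Prop :=
  j ∈ B.J₀ \ B.N ∧ ∀ j' ∈ B.J₀, j' ≠ j → I.vars j 2 ∉ varSet I j' ∧ I.vars j 3 ∉ varSet I j'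

/-- **Which tree edges of a fundamental set are switched on by `W = privs S ∪ R`**: exactly those of `S`, provided `S` consists of private edges
and `R` contains no full AND pair of a tree edge of `D e` outside `S`. -/
theorem both_mem_iff {e : Fin m} (hDe : B.D e ⊆ B.J₀ \ B.N) {S : Finset (Fin m)} (hS : ∀ j ∈ S, PrivEdge I B j)
    {R : Finset (Fin n)} (hR : ∀ k ∈ B.D e, k ∉ S → ¬ (I.vars k 2 ∈ R ∧ I.vars k 3 ∈ R)) :
    ∀ k ∈ B.D e, (I.vars k 2 ∈ privs I S ∪ R ∧ I.vars k 3 ∈ privs I S ∪ R) ↔ k ∈ S := by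
  intro k hk
  have hkJ : k ∈ B.J₀ := (mem_sdiff.1 (hDe hk)).1
  constructor
  · rintro ⟨h2, h3⟩
    by_contra hkS
    -- an AND variable of `k` inside `privs S` would be shared with a private edge of `S`
    have hno : ∀ s : Fin 4, 2 ≤ s.val → I.vars k s ∉ privs I S := by
      intro s hs hv
      obtain ⟨j, hj, hjv⟩ := (mem_privs I).1 hv
      have hne : k ≠ j := fun h => hkS (h ▸ hj)
      obtain ⟨-, hpriv⟩ := hS j hj
      have hk' := hpriv k hkJ hne
      rcases hjv with h | h
      · exact hk'.1 (h ▸ vars_mem_varSet I k s)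
      · exact hk'.2 (h ▸ vars_mem_varSet I k s)
    rcases mem_union.1 h2 with h2 | h2
    · exact hno 2 (by decide) h2
    rcases mem_union.1 h3 with h3 | h3
    · exact hno 3 (by decide) h3
    exact hR k hk hkS ⟨h2, h3⟩
  · intro hkS
    exact ⟨mem_union_left _ ((mem_privs I).2 ⟨k, hkS, Or.inl rfl⟩), mem_union_left _ ((mem_privs I).2 ⟨k, hkS, Or.inr rfl⟩)⟩

/-- **The prescribed products at `𝟙_{privs S ∪ R}`** under the hypotheses of `both_mem_iff`: `u_e = γ_e + #(D e ∩ S)`. -/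
theorem u_ind_on (hW : B.WF I) {e : Fin m} (he : e ∈ B.N) {S : Finset (Fin m)} (hS : ∀ j ∈ S, PrivEdge I B j)
    {R : Finset (Fin n)} (hR : ∀ k ∈ B.D e, k ∉ S → ¬ (I.vars k 2 ∈ R ∧ I.vars k 3 ∈ R)) :
    (sys I B).u e (ind (privs I S ∪ R)) = gam B e + (((B.D e).filter fun k => k ∈ S).card : ZMod 2) :=
  u_ind I B e (both_mem_iff I (hW.hD e he) hS hR)

/-- No tree edge other than a private `π` has a full AND pair inside `{v, w}` when `v` is an AND variable of `π` and `w` is not its mate; and `π`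
itself does not (its pair is `{v, v'}` with `v' ∉ {v, w}`). -/
theorem no_pair_in (hI : I.IsPure xorAndPred) {π : Fin m} (hπ : PrivEdge I B π) {s : Fin 4} (hs : s = 2 ∨ s = 3) {w : Fin n}
    (hwv : w ≠ I.vars π 2) (hwv' : w ≠ I.vars π 3) {R : Finset (Fin n)} (hRsub : R ⊆ {I.vars π s, w}) :
    ∀ k ∈ B.J₀, ¬ (I.vars k 2 ∈ R ∧ I.vars k 3 ∈ R) := by
  intro k hk ⟨h2, h3⟩
  have h2' := hRsub h2
  have h3' := hRsub h3
  simp only [mem_insert, mem_singleton] at h2' h3'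
  by_cases hkπ : k = π
  · subst hkπ
    have h23 : I.vars k 2 ≠ I.vars k 3 := fun h => absurd (hI.2 k h) (by decide)
    rcases hs with rfl | rfl
    · rcases h3' with h | h
      · exact h23 h.symm
      · exact hwv' h.symm
    · rcases h2' with h | h
      · exact h23 h
      · exact hwv h.symm
  · obtain ⟨-, hpriv⟩ := hπ
    have hk' := hpriv k hk hkπ
    have hvs : I.vars π s ∉ varSet I k := by
      rcases hs with rfl | rfl
      · exact hk'.1
      · exact hk'.2
    rcases h2' with h | h
    · exact hvs (h ▸ vars_mem_varSet I k 2)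
    rcases h3' with h' | h'
    · exact hvs (h' ▸ vars_mem_varSet I k 3)
    -- both AND variables of `k` equal `w`: impossible (purity)
    exact absurd (hI.2 k (h.trans h'.symm)) (by decide)

/-- **CORNER SQUARE.**  See the module docstring.  `q` is any quadratic (polar identity with `Bq`) constant on the corner `{u_p = u_q = 0}`. -/
theorem corner_square (hI : I.IsPure xorAndPred) (hD : CrossData I r B e_p e_q g₀)
    {q : (Fin n → ZMod 2) → ZMod 2} {Bq : LinearMap.BilinForm (ZMod 2) (Fin n → ZMod 2)} (hq : ∀ x y, q (x + y) = q x + q y + q 0 + Bq x y)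
    {κ : ZMod 2} (hK : ∀ a, (sys I B).u e_p a = 0 → (sys I B).u e_q a = 0 → q a = κ)
    {S : Finset (Fin m)} (hS : ∀ j ∈ S, PrivEdge I B j)
    (hSp : gam B e_p + (((B.D e_p).filter fun k => k ∈ S).card : ZMod 2) = 0)
    (hSq : gam B e_q + (((B.D e_q).filter fun k => k ∈ S).card : ZMod 2) = 0)
    {π : Fin m} (hπ : PrivEdge I B π) (hπS : π ∉ S) {s : Fin 4} (hs : s = 2 ∨ s = 3)
    {w : Fin n} (hwv : w ≠ I.vars π 2) (hwv' : w ≠ I.vars π 3) (hwS : w ∉ privs I S) :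
    Bq (Pi.single w 1) (Pi.single (I.vars π s) 1) = 0 := by
  classical
  have hW := hD.wf
  set v := I.vars π s with hvdef
  have hvS : v ∉ privs I S := by
    intro hv
    obtain ⟨j, hj, hjv⟩ := (mem_privs I).1 hv
    have hne : j ≠ π := fun h => hπS (h ▸ hj)
    have hk := hπ.2 j (mem_sdiff.1 (hS j hj).1).1 hne
    have : I.vars π s ∉ varSet I j := by rcases hs with rfl | rfl; exacts [hk.1, hk.2]
    rcases hjv with h | h
    · exact this (by rw [← hvdef, ← h]; exact vars_mem_varSet I j 2)
    · exact this (by rw [← hvdef, ← h]; exact vars_mem_varSet I j 3)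
  have hvw : v ≠ w := by rcases hs with rfl | rfl; exacts [fun h => hwv h.symm, fun h => hwv' h.symm]
  -- the four corner points
  have hcorner : ∀ R : Finset (Fin n), R ⊆ {v, w} →
      (sys I B).u e_p (ind (privs I S ∪ R)) = 0 ∧ (sys I B).u e_q (ind (privs I S ∪ R)) = 0 := by
    intro R hR
    have hnp := no_pair_in I hI hπ hs hwv hwv' hR
    refine ⟨?_, ?_⟩
    · rw [u_ind_on I hW hD.mem_p hS (fun k hk _ => hnp k (mem_sdiff.1 (hW.hD e_p hD.mem_p hk)).1)]; exact hSp
    · rw [u_ind_on I hW hD.mem_q hS (fun k hk _ => hnp k (mem_sdiff.1 (hW.hD e_q hD.mem_q hk)).1)]; exact hSq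
  have hq_at : ∀ R : Finset (Fin n), R ⊆ {v, w} → q (ind (privs I S ∪ R)) = κ := fun R hR =>
    hK _ (hcorner R hR).1 (hcorner R hR).2
  -- as translates of `𝟙_{privs S}`
  have h0 : privs I S ∪ ∅ = privs I S := union_empty _
  have hv1 : privs I S ∪ {v} = insert v (privs I S) := by
    ext u; simp only [mem_union, mem_insert, mem_singleton]; tauto
  have hw1 : privs I S ∪ {w} = insert w (privs I S) := by
    ext u; simp only [mem_union, mem_insert, mem_singleton]; tauto
  have hvw1 : privs I S ∪ {v, w} = insert w (insert v (privs I S)) := by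
    ext u; simp only [mem_union, mem_insert, mem_singleton]; tauto
  have e00 := hq_at ∅ (empty_subset _)
  have e10 := hq_at {v} (by simp)
  have e01 := hq_at {w} (by simp)
  have e11 := hq_at {v, w} subset_rfl
  rw [h0] at e00
  rw [hv1, ind_insert hvS] at e10
  rw [hw1, ind_insert hwS] at e01
  rw [hvw1, ind_insert (by rw [mem_insert]; push Not; exact ⟨hvw.symm, hwS⟩), ind_insert hvS] at e11
  have := polar_zero_of_square hq e00 e10 e01 e11
  -- `Bq` is used symmetrically: the polar identity makes it symmetric on these arguments
  have hsymm : Bq (Pi.single w 1) (Pi.single v 1) = Bq (Pi.single v 1) (Pi.single w 1) := by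
    have h1 := hq (Pi.single v 1) (Pi.single w 1)
    have h2 := hq (Pi.single w 1) (Pi.single v 1)
    rw [show (Pi.single w (1 : ZMod 2) : Fin n → ZMod 2) + Pi.single v 1 = Pi.single v 1 + Pi.single w 1 from add_comm _ _] at h2
    have e3 : ∀ s a b c x y : ZMod 2, s = a + b + c + x → s = b + a + c + y → y = x := by decide
    exact e3 _ _ _ _ _ _ h1 h2
  rw [hsymm]
  exact this

/-- **CORNER PAIR.**  With `S`, `π`, `v = vars π s` as in `corner_square`: `q(e_v) + q(0) = Bq(𝟙_{privs S}, e_v)`. -/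
theorem corner_pair (hI : I.IsPure xorAndPred) (hD : CrossData I r B e_p e_q g₀)
    {q : (Fin n → ZMod 2) → ZMod 2} {Bq : LinearMap.BilinForm (ZMod 2) (Fin n → ZMod 2)} (hq : ∀ x y, q (x + y) = q x + q y + q 0 + Bq x y)
    {κ : ZMod 2} (hK : ∀ a, (sys I B).u e_p a = 0 → (sys I B).u e_q a = 0 → q a = κ)
    {S : Finset (Fin m)} (hS : ∀ j ∈ S, PrivEdge I B j)
    (hSp : gam B e_p + (((B.D e_p).filter fun k => k ∈ S).card : ZMod 2) = 0)
    (hSq : gam B e_q + (((B.D e_q).filter fun k => k ∈ S).card : ZMod 2) = 0)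
    {π : Fin m} (hπ : PrivEdge I B π) (hπS : π ∉ S) {s : Fin 4} (hs : s = 2 ∨ s = 3) :
    q (Pi.single (I.vars π s) 1) + q 0 = Bq (ind (privs I S)) (Pi.single (I.vars π s) 1) := by
  classical
  have hW := hD.wf
  set v := I.vars π s with hvdef
  have hvS : v ∉ privs I S := by
    intro hv
    obtain ⟨j, hj, hjv⟩ := (mem_privs I).1 hv
    have hne : j ≠ π := fun h => hπS (h ▸ hj)
    have hk := hπ.2 j (mem_sdiff.1 (hS j hj).1).1 hne
    have : I.vars π s ∉ varSet I j := by rcases hs with rfl | rfl; exacts [hk.1, hk.2]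
    rcases hjv with h | h
    · exact this (by rw [← hvdef, ← h]; exact vars_mem_varSet I j 2)
    · exact this (by rw [← hvdef, ← h]; exact vars_mem_varSet I j 3)
  -- a variable `w ∉ {v, v'}` exists only implicitly; we use `R ⊆ {v}` and `no_pair_in` with `w := v'`'s role played by purity directly
  have hnp : ∀ R : Finset (Fin n), R ⊆ {v} → ∀ k ∈ B.J₀, ¬ (I.vars k 2 ∈ R ∧ I.vars k 3 ∈ R) := by
    intro R hR k hk ⟨h2, h3⟩
    have h2' := mem_singleton.1 (hR h2)
    have h3' := mem_singleton.1 (hR h3)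
    exact absurd (hI.2 k (h2'.trans h3'.symm)) (by decide)
  have hcorner : ∀ R : Finset (Fin n), R ⊆ {v} →
      (sys I B).u e_p (ind (privs I S ∪ R)) = 0 ∧ (sys I B).u e_q (ind (privs I S ∪ R)) = 0 := by
    intro R hR
    refine ⟨?_, ?_⟩
    · rw [u_ind_on I hW hD.mem_p hS (fun k hk _ => hnp R hR k (mem_sdiff.1 (hW.hD e_p hD.mem_p hk)).1)]; exact hSp
    · rw [u_ind_on I hW hD.mem_q hS (fun k hk _ => hnp R hR k (mem_sdiff.1 (hW.hD e_q hD.mem_q hk)).1)]; exact hSq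
  have e0 := hK _ (hcorner ∅ (empty_subset _)).1 (hcorner ∅ (empty_subset _)).2
  have e1 := hK _ (hcorner {v} subset_rfl).1 (hcorner {v} subset_rfl).2
  rw [union_empty] at e0
  rw [show privs I S ∪ {v} = insert v (privs I S) by ext u; simp only [mem_union, mem_insert, mem_singleton]; tauto,
    ind_insert hvS] at e1
  exact lin_eq_of_pair hq e0 e1

end Instance

end Summit.PneNP.PneNP.Theorems.PstarCrossCorner
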